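import Mathlib
import HarnessLib
import Summits.CriticalPhenomena.Statement
import Literature.Probability.RandomPlanarGeometry.SAWParafermion
import Literature.Probability.RandomPlanarGeometry.SLEUniquenessInLaw
import Literature.Probability.RandomPlanarGeometry.SAWCount

/-! Elaboration check of the REPAIRED (first-step) signatures for stmt-17872 / stmt-17873, in the exact
header context of the route file `Theses/SAWTwistedSelfEnergy.lean` (same imports, namespace, opens). -/

namespace Summit.CriticalPhenomena.SAWScalingLimit.Theses.SAWTwistedSelfEnergy.RepairCheck

open scoped BigOperators Topology Manifold Classical MeasureTheory ProbabilityTheory Matrix InnerProductSpace ComplexConjugate ContinuousMap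
open Filter Set Function TopologicalSpace MeasureTheory

def TwistedKernelSummableR : Prop :=
  let dir : Fin 4 → Literature.Probability.LatticeModels.Site 2 := ![![1, 0], ![0, 1], ![-1, 0], ![0, -1]]; let σ : ℝ := 5 / 8; let T : Matrix (Fin 4) (Fin 4) ℂ := fun a b => if dir b = -dir a then 0 else Complex.exp (-Complex.I * σ * (Literature.Probability.LatticeModels.turning (-Literature.Probability.LatticeModels.Site.toComplex (dir a)) 0 (Literature.Probability.LatticeModels.Site.toComplex (dir b)) : ℝ)); let G : ℕ → Literature.Probability.LatticeModels.Site 2 → Matrix (Fin 4) (Fin 4) ℂ := fun n z ι κ => if n = 0 then (if z = 0 ∧ ι = κ then 1 else 0) else ∑ p ∈ ((Literature.Probability.LatticeModels.zdGraph 2).finsetWalkLength n (0 : Literature.Probability.LatticeModels.Site 2) z).filter (fun p => p.IsPath), (if p.getVert 1 = -dir ι ∨ z - p.getVert (n - 1) ≠ dir κ then 0 else Complex.exp (-Complex.I * σ * (Literature.Probability.LatticeModels.winding ((-Literature.Probability.LatticeModels.Site.toComplex (dir ι)) :: (p.support.map Literature.Probability.LatticeModels.Site.toComplex)) : ℝ)));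 let IsLaceKernel : (ℕ → Literature.Probability.LatticeModels.Site 2 → Matrix (Fin 4) (Fin 4) ℂ) → Prop := fun K => (∀ n z, z ∉ Literature.Probability.LatticeModels.box 2 n → K n z = 0) ∧ (∀ n, 1 ≤ n → ∀ z, G n z = Matrix.of (fun ι κ => ∑ lam : Fin 4, T ι lam * G (n - 1) (z - dir lam) lam κ) + ∑ m ∈ Finset.Icc 1 n, ∑ y ∈ Literature.Probability.LatticeModels.box 2 m, K m y * G (n - m) (z - y)); ∀ K : ℕ → Literature.Probability.LatticeModels.Site 2 → Matrix (Fin 4) (Fin 4) ℂ, IsLaceKernel K → Summable (fun p : ℕ × Literature.Probability.LatticeModels.Site 2 => Literature.Probability.RandomPlanarGeometry.SAW.criticalFugacity ^ p.1 * ∑ ι : Fin 4, ∑ κ : Fin 4, ‖K p.1 p.2 ι κ‖)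

def TwistedKernelTailIndexR : Prop :=
  let dir : Fin 4 → Literature.Probability.LatticeModels.Site 2 := ![![1, 0], ![0, 1], ![-1, 0], ![0, -1]]; let σ : ℝ := 5 / 8; let T : Matrix (Fin 4) (Fin 4) ℂ := fun a b => if dir b = -dir a then 0 else Complex.exp (-Complex.I * σ * (Literature.Probability.LatticeModels.turning (-Literature.Probability.LatticeModels.Site.toComplex (dir a)) 0 (Literature.Probability.LatticeModels.Site.toComplex (dir b)) : ℝ)); let G : ℕ → Literature.Probability.LatticeModels.Site 2 → Matrix (Fin 4) (Fin 4) ℂ := fun n z ι κ => if n = 0 then (if z = 0 ∧ ι = κ then 1 else 0) else ∑ p ∈ ((Literature.Probability.LatticeModels.zdGraph 2).finsetWalkLength n (0 : Literature.Probability.LatticeModels.Site 2) z).filter (fun p => p.IsPath), (if p.getVert 1 = -dir ι ∨ z - p.getVert (n - 1) ≠ dir κ then 0 else Complex.exp (-Complex.I * σ * (Literature.Probability.LatticeModels.winding ((-Literature.Probability.LatticeModels.Site.toComplex (dir ι)) :: (p.support.map Literature.Probability.LatticeModels.Site.toComplex)) : ℝ))); let IsLaceKernel : (ℕ → Literature.Probability.LatticeModels.Site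 2 → Matrix (Fin 4) (Fin 4) ℂ) → Prop := fun K => (∀ n z, z ∉ Literature.Probability.LatticeModels.box 2 n → K n z = 0) ∧ (∀ n, 1 ≤ n → ∀ z, G n z = Matrix.of (fun ι κ => ∑ lam : Fin 4, T ι lam * G (n - 1) (z - dir lam) lam κ) + ∑ m ∈ Finset.Icc 1 n, ∑ y ∈ Literature.Probability.LatticeModels.box 2 m, K m y * G (n - m) (z - y)); ∀ K : ℕ → Literature.Probability.LatticeModels.Site 2 → Matrix (Fin 4) (Fin 4) ℂ, IsLaceKernel K → (∀ s : ℝ, 0 ≤ s → s < 3 / 4 → Summable (fun p : ℕ × Literature.Probability.LatticeModels.Site 2 => Literature.Probability.RandomPlanarGeometry.SAW.criticalFugacity ^ p.1 * ‖Literature.Probability.LatticeModels.Site.toComplex p.2‖ ^ s * ∑ ι : Fin 4, ∑ κ : Fin 4, ‖K p.1 p.2 ι κ‖)) ∧ (∀ s : ℝ, 3 / 4 < s → ¬ Summable (fun p : ℕ × Literature.Probability.LatticeModels.Site 2 => Literature.Probability.RandomPlanarGeometry.SAW.criticalFugacity ^ p.1 * ‖Literature.Probability.LatticeModels.Site.toComplex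 p.2‖ ^ s * ∑ ι : Fin 4, ∑ κ : Fin 4, ‖K p.1 p.2 ι κ‖))

end Summit.CriticalPhenomena.SAWScalingLimit.Theses.SAWTwistedSelfEnergy.RepairCheck
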